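import Literature.Barriers.CriticalPhenomena.PlaquetteWalkHoleRootRowOnly
import HarnessLib

/-!
# Barrier catalogue (SAWScalingLimit): in the HOLE COLUMN a wound class-`B2a` walk of limit cost `7` with a slanted end crosses its rhombus STRAIGHT
(«HOLE COLUMN: SLANTED LEVEL-7 MEMBERS HAVE A STRAIGHT FIRST ARC»)

`Z → ∞` limit model of the printed Yang–Baxter weights [GlazmanManolescu2019, §1, eq. (1)]; the «RECTANGLE COEFFICIENT» line of the venture lane «pcv-sawmu»
(b-engine-1 g28), first structural step of the HOLE-COLUMN programme (FINDING-YB-HOLE-COLUMN-FOUR-PHASE, DESIGN-next b-engine-1 g28 §4 (H3b)): west of the root column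
the level-`5` coefficient vanishes (`PlaquetteWalkHoleRootLevelFiveClasses`) and the first candidate is the level-`7` wound sum; at the HOLE-COLUMN cells
`(w.1 − 1, w.2 + y)`, `y ≠ 0`, the census (kit j298353) finds exactly two kinds of cost-`7` member — class-`B2a` walks with a STRAIGHT first arc and a slanted end, and
the extensions of cost-`9` vertical-end parents. This file proves the first exclusion behind that list:

* ★★★ `ΩG.not_cost_seven_slanted_turn_holeColumn`: no wound class-`B2a` walk of limit cost `7` from the hole root `w.side W` (hole `(w.1 − 1, w.2)` absent) ending on a
  SLANTED side of a rhombus `r` of the hole column (`r.1 = w.1 − 1`) has a TURNING first arc in `r`. EIGHT ISOLATED TURNS: the two top-row turns, the two bottom-row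
  turns, the root-row turn `τ` (east end of the first turn's chain), `r` itself, the end of the horizontal chain of `r`, and — the eighth — the end of the vertical chain of
  `r` towards the hole (it cannot reach the bottom row: the hole is in the way) or the last plaquette / the end of ITS chain towards the hole; but `n_{u₁} + n_{u₂} = 7`.

[GlazmanManolescu2019 §1 Fig. 1, eq. (1), Lemma 2.1, Remark 2.2; Glazman2015WeightedSAW Lemma 3.1 (proof, pp. 6–7); CourantRobbins1958 Ch. V App. §2]
-/

noncomputable section

namespace Literature.Probability.RandomPlanarGeometry.SAW.YangBaxter

open Real
open Literature.Barriers.CriticalPhenomena.PlaquetteWalk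

open private fc_fh fh_add_Mv three_le_Mv from Literature.Probability.RandomPlanarGeometry.YangBaxterSAWGeneralDomain

namespace ΩG

variable {D : Set Face} {w r : Face} {ω : ΩG D (w.side .W) r}

/-- The case `w.2 < r.2` of `not_cost_seven_slanted_turn_holeColumn`. [cite: GlazmanManolescu2019, §1, Fig. 1 and eq. (1); Lemma 2.1; Remark 2.2]
[cite: Glazman2015WeightedSAW, Lemma 3.1 (proof, pp. 6–7)] [cite: CourantRobbins1958, Ch. V Appendix §2 (the even–odd rule)] -/
theorem not_cost_seven_slanted_turn_holeColumn_above (hh : holeFaceW w ∉ D) (hr : RootedFace D (w.side .W) r) (h : ω.IsB2a)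
    (hA : ω.AJ hr h (toC (midPt (w.side .W))) ≠ 0) (hc : cost (slotOfSide ω.1) ω.2.mids = 7) (hz : ω.1 = .N ∨ ω.1 = .S)
    (hNS : arcKind (ω.2.sIn ω.2.firstHitG) (ω.2.sOut ω.2.firstHitG) ≠ .straight) (hcol : r.1 = w.1 - 1) (habove : w.2 < r.2) : False := by
  classical
  set n := ω.2.arcs.length with hn
  ---------------------------------------------------------------- basics
  have hF := ω.fh_lt h
  have hlen : 0 < n := by omega
  have h0w : ω.2.fc 0 = w := fc_zero_eq_root w hh ω.2 hlen
  have h0W : ω.2.sIn 0 = .W := YBWalk.sIn_zero_eq_W hh ω.2 hlen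
  have h0E : ω.2.sIn 0 ≠ .E := by rw [h0W]; decide
  have h0N : ω.2.sIn 0 ≠ .N := by rw [h0W]; decide
  have h0S : ω.2.sIn 0 ≠ .S := by rw [h0W]; decide
  have hfcF := (fc_fh ω hr h).1
  have hsvr : ∀ l < n, ω.2.fc l = ω.2.fc ω.2.firstHitG → l = ω.2.firstHitG := fun l hl e => eq_firstHitG_of_fc_eq hr h hl e
  have hfne3 : ω.2.firstHitG + 3 ≤ n := by have := three_le_Mv hr h; have := fh_add_Mv h; unfold ΩG.Mv at *; omega
  have hn1 : n - 1 < n := by omega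
  have hlast := sOut_last_NS_of_slanted h hz
  have hzE : ω.2.sOut (n - 1) ≠ .E := by rcases hlast with e | e <;> rw [e] <;> decide
  have hzW : ω.2.sOut (n - 1) ≠ .W := by rcases hlast with e | e <;> rw [e] <;> decide
  have hlastr := fc_last_ne_root hr h
  have hLD : ω.2.fc (n - 1) ∈ D := (YBWalk.arcFace_arcAt hn1).2
  have hmemD : ∀ {c : Face} {s : Side}, ω.2.UsesSide c s → c ∈ D := by
    intro c s hu
    obtain ⟨j, hj, hfj⟩ := ω.2.exists_fc_eq_of_usesSide hu
    rw [← hfj]; exact (YBWalk.arcFace_arcAt hj).2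
  have hnotD : ∀ {c : Face}, c ∈ D → c = holeFaceW w → False := fun hc e => hh (e ▸ hc)
  have hzside : (ω.2.fc (n - 1)).side (ω.2.sOut (n - 1)) = r.side ω.1 := by
    obtain ⟨-, hout⟩ := ω.2.side_sIn_eq_nth hn1
    rwa [show n - 1 + 1 = n by omega, ω.2.nth_length] at hout
  -- the side of `r` carrying the end is not used by the arc of `r`
  have hrside : ∀ s, ω.2.UsesSide r s → r.side s ≠ r.side ω.1 := by
    rintro s ⟨l, hl, hfl, hs⟩ e
    have hl' := hsvr l hl (hfl.trans hfcF.symm)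
    obtain ⟨hin, hout⟩ := ω.2.side_sIn_eq_nth hl
    rw [hfl] at hin hout
    rw [← ω.2.nth_length] at e
    rcases hs with hs | hs
    · rw [hs] at hin; have := ω.2.nth_inj (show l ≤ n by omega) le_rfl (hin.symm.trans e).symm.symm; omega
    · rw [hs] at hout; have := ω.2.nth_inj (show l + 1 ≤ n by omega) le_rfl (hout.symm.trans e).symm.symm; omega
  -- the last plaquette: `ω.1 = N`: `L = (r.1, r.2 + 1)`, left through `S`; `ω.1 = S`: `L = (r.1, r.2 − 1)`, left through `N`
  have hLcases : (ω.1 = .N ∧ ω.2.sOut (n - 1) = .S ∧ ω.2.fc (n - 1) = (r.1, r.2 + 1)) ∨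
      (ω.1 = .S ∧ ω.2.sOut (n - 1) = .N ∧ ω.2.fc (n - 1) = (r.1, r.2 - 1)) := by
    rcases hfc : ω.2.fc (n - 1) with ⟨x, y⟩
    rw [hfc] at hzside hlastr
    rcases r with ⟨r1, r2⟩
    simp only at hlastr ⊢
    generalize hs : ω.2.sOut (n - 1) = s at hzside hlast ⊢
    generalize ht : ω.1 = t at hzside hz ⊢
    rcases hz with rfl | rfl <;> rcases hlast with rfl | rfl <;>
      simp only [Face.side, MidEdge.slant.injEq, Prod.mk.injEq, reduceCtorEq, false_and, and_false, true_and, false_or, or_false] at hzside ⊢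
    · exact absurd (Prod.ext hzside.1 (by simp only; omega)) hlastr
    · refine ⟨?_, ?_⟩ <;> omega
    · refine ⟨?_, ?_⟩ <;> omega
    · exact absurd (Prod.ext hzside.1 (by simp only; omega)) hlastr
  ---------------------------------------------------------------- isolated turns: seven, as `P`-cells
  have h7 : cfgCount ω.2.mids [.corner] + cfgCount ω.2.mids [.coCorner] = 7 := by
    have hcost : cost (slotOfSide ω.1) ω.2.mids =
        cfgCount ω.2.mids [.corner] + cfgCount ω.2.mids [.coCorner] + (1 - slotDeg (slotOfSide ω.1)) := rfl
    have hd : slotDeg (slotOfSide ω.1) = 1 := by rcases hz with e | e <;> rw [e] <;> rfl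
    rw [hcost, hd] at hc; omega
  let P : Face → Prop := fun f => f ∈ facesL ω.2.mids ∧ (kindsL ω.2.mids f = [.corner] ∨ kindsL ω.2.mids f = [.coCorner])
  have hPiso : ∀ k < n, (∀ l < n, ω.2.fc l = ω.2.fc k → l = k) → arcKind (ω.2.sIn k) (ω.2.sOut k) ≠ .straight → P (ω.2.fc k) :=
    fun k hk hsv hkind => isolated_turn hk hsv hkind
  have hle7 : ∀ T : Finset Face, (∀ f ∈ T, P f) → T.card ≤ 7 := by
    intro T hT; have := YBWalk.card_le_cfgCount_add ω.2.mids T hT; omega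
  have hPr : P r := by have := hPiso _ hF hsvr hNS; rwa [hfcF] at this
  -- top and bottom turns
  obtain ⟨Y, hYw, hY, Tt, hTtP, hTtrow, hTtcard⟩ := two_top_turns hh hr h hA
  have hTt2 : 1 < Tt.card := by
    rcases hTtcard with h2 | ⟨-, hzv, -⟩
    · omega
    · exfalso; rcases hz with e | e <;> rcases hzv with e' | e' <;> rw [e] at e' <;> exact absurd e' (by decide)
  obtain ⟨t₁, ht₁, t₂, ht₂, ht12⟩ := Finset.one_lt_card.1 hTt2
  have hPt₁ : P t₁ := hTtP t₁ ht₁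
  have hPt₂ : P t₂ := hTtP t₂ ht₂
  have ht₁row : t₁.2 = Y := hTtrow t₁ ht₁
  have ht₂row : t₂.2 = Y := hTtrow t₂ ht₂
  obtain ⟨Y', hY'w, hY', Tb, hTbP, hTbrow, hTbcard⟩ := two_bottom_turns hh hr h hA
  have hTb2 : 1 < Tb.card := by
    rcases hTbcard with h2 | ⟨-, hzv, -⟩
    · omega
    · exfalso; rcases hz with e | e <;> rcases hzv with e' | e' <;> rw [e] at e' <;> exact absurd e' (by decide)
  obtain ⟨b₁, hb₁, b₂, hb₂, hb12⟩ := Finset.one_lt_card.1 hTb2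
  have hPb₁ : P b₁ := hTbP b₁ hb₁
  have hPb₂ : P b₂ := hTbP b₂ hb₂
  have hb₁row : b₁.2 = Y' := hTbrow b₁ hb₁
  have hb₂row : b₂.2 = Y' := hTbrow b₂ hb₂
  have hNtop := forall_top_ne_N hh hr h hY (by omega)
  obtain ⟨X', -, hX', -⟩ := exists_right_entry_turn hh hr h
  obtain ⟨X, hXw, hX, -⟩ := exists_left_entry_turn hh hr h hA
  have hrY : r.2 ≤ Y := by have := hY _ hF; rwa [hfcF] at this
  ---------------------------------------------------------------- the first turn and the root-row turn `τ = (τ1, w.2)`, `τ1 ≥ w.1`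
  have hexk : ∃ k, k < n ∧ arcKind (ω.2.sIn k) (ω.2.sOut k) ≠ .straight := ⟨_, hF, hNS⟩
  obtain ⟨hk₁, -⟩ := Nat.find_spec hexk
  set k₁ := Nat.find hexk with hk₁def
  have hstr : ∀ i < k₁, arcKind (ω.2.sIn i) (ω.2.sOut i) = .straight := by
    intro i hi; by_contra hne; exact Nat.find_min hexk hi ⟨by omega, hne⟩
  obtain ⟨hrun, -⟩ := ω.2.initial_run hh hk₁ hstr
  obtain ⟨hfk, hWk⟩ := hrun k₁ le_rfl
  have hp₁W : ω.2.UsesSide (w.1 + k₁, w.2) .W := ⟨k₁, hk₁, hfk, Or.inl hWk⟩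
  obtain ⟨τ1, hPτ, hτ1w⟩ : ∃ τ1 : ℤ, P (τ1, w.2) ∧ w.1 + k₁ ≤ τ1 := by
    by_cases hpE : ω.2.UsesSide (w.1 + k₁, w.2) .E
    · obtain ⟨M, hWall, -, hend⟩ := ω.2.chain_E hX' hpE
      rcases hend with ⟨hM1, hnot⟩ | ⟨-, hs0⟩ | ⟨-, hsZ⟩
      · obtain ⟨i', hi', hfc', hsv', -, -, -, hk'⟩ := ω.2.isolated_of_usesSide_not_opp (hWall M hM1 le_rfl) hnot
        refine ⟨w.1 + k₁ + M, ?_, by omega⟩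
        have := hPiso i' hi' hsv' hk'; rw [hfc'] at this; exact this
      · exact absurd hs0 h0E
      · exact absurd hsZ hzE
    · obtain ⟨i', hi', hfc', hsv', -, -, -, hk'⟩ := ω.2.isolated_of_usesSide_not_opp hp₁W hpE
      refine ⟨w.1 + k₁, ?_, le_rfl⟩
      have := hPiso i' hi' hsv' hk'; rw [hfc'] at this; exact this
  -- `r` is not in the top row
  have hrtop : r.2 ≠ Y := by
    intro hrow
    rcases hLcases with ⟨-, -, hL⟩ | ⟨hωS, -, -⟩
    · have := hY _ hn1; rw [hL] at this; simp only at this; omega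
    · obtain ⟨hn1', hn2'⟩ := hNtop _ hF (by rw [hfcF]; exact hrow)
      have hne := ω.2.sIn_ne_sOut hF
      have hnoS : ¬(ω.2.sIn ω.2.firstHitG = .S ∨ ω.2.sOut ω.2.firstHitG = .S) :=
        fun hs => hrside .S ⟨_, hF, hfcF, hs⟩ (by rw [hωS])
      apply hNS
      revert hne hnoS hn1' hn2'; cases ω.2.sIn ω.2.firstHitG <;> cases ω.2.sOut ω.2.firstHitG <;> decide
  ---------------------------------------------------------------- two more isolated turns strictly between the extreme rows, off the root row and distinct from `r`, are too many
  have hne_of_row : ∀ f g : Face, f.2 ≠ g.2 → f ≠ g := fun f g hfg e => hfg (by rw [e])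
  have houts2 : ∀ g₁ g₂ : Face, P g₁ → P g₂ → g₁ ≠ g₂ → Y' < g₁.2 → g₁.2 < Y → g₁.2 ≠ w.2 → g₁ ≠ r →
      Y' < g₂.2 → g₂.2 < Y → g₂.2 ≠ w.2 → g₂ ≠ r → False := by
    intro g₁ g₂ hP₁ hP₂ hg12 a1 a2 a3 a4 c1 c2 c3 c4
    have n1 : g₁ ≠ t₁ := hne_of_row _ _ (by rw [ht₁row]; omega)
    have n2 : g₁ ≠ t₂ := hne_of_row _ _ (by rw [ht₂row]; omega)
    have n3 : g₁ ≠ b₁ := hne_of_row _ _ (by rw [hb₁row]; omega)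
    have n4 : g₁ ≠ b₂ := hne_of_row _ _ (by rw [hb₂row]; omega)
    have n5 : g₁ ≠ ((τ1 : ℤ), w.2) := hne_of_row _ _ (by simp only; exact a3)
    have m1 : g₂ ≠ t₁ := hne_of_row _ _ (by rw [ht₁row]; omega)
    have m2 : g₂ ≠ t₂ := hne_of_row _ _ (by rw [ht₂row]; omega)
    have m3 : g₂ ≠ b₁ := hne_of_row _ _ (by rw [hb₁row]; omega)
    have m4 : g₂ ≠ b₂ := hne_of_row _ _ (by rw [hb₂row]; omega)
    have m5 : g₂ ≠ ((τ1 : ℤ), w.2) := hne_of_row _ _ (by simp only; exact c3)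
    have h01 : t₁ ≠ t₂ := ht12
    have h02 : t₁ ≠ b₁ := hne_of_row _ _ (by rw [ht₁row, hb₁row]; omega)
    have h03 : t₁ ≠ b₂ := hne_of_row _ _ (by rw [ht₁row, hb₂row]; omega)
    have h04 : t₁ ≠ ((τ1 : ℤ), w.2) := hne_of_row _ _ (by rw [ht₁row]; simp only; omega)
    have h05 : t₁ ≠ r := hne_of_row _ _ (by rw [ht₁row]; exact fun e => hrtop e.symm)
    have h15 : t₂ ≠ r := hne_of_row _ _ (by rw [ht₂row]; exact fun e => hrtop e.symm)
    have h12 : t₂ ≠ b₁ := hne_of_row _ _ (by rw [ht₂row, hb₁row]; omega)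
    have h13 : t₂ ≠ b₂ := hne_of_row _ _ (by rw [ht₂row, hb₂row]; omega)
    have h14 : t₂ ≠ ((τ1 : ℤ), w.2) := hne_of_row _ _ (by rw [ht₂row]; simp only; omega)
    have h23 : b₁ ≠ b₂ := hb12
    have h24 : b₁ ≠ ((τ1 : ℤ), w.2) := hne_of_row _ _ (by rw [hb₁row]; simp only; omega)
    have h25 : b₁ ≠ r := hne_of_row _ _ (by rw [hb₁row]; omega)
    have h34 : b₂ ≠ ((τ1 : ℤ), w.2) := hne_of_row _ _ (by rw [hb₂row]; simp only; omega)
    have h35 : b₂ ≠ r := hne_of_row _ _ (by rw [hb₂row]; omega)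
    have h45 : ((τ1 : ℤ), w.2) ≠ r := by intro e'; have := congrArg Prod.fst e'; simp only at this; omega
    have hT : ∀ f ∈ ({g₁, g₂, t₁, t₂, b₁, b₂, ((τ1 : ℤ), w.2), r} : Finset Face), P f := by
      intro f hf
      simp only [Finset.mem_insert, Finset.mem_singleton] at hf
      rcases hf with rfl | rfl | rfl | rfl | rfl | rfl | rfl | rfl
      exacts [hP₁, hP₂, hPt₁, hPt₂, hPb₁, hPb₂, hPτ, hPr]
    have hcard : ({g₁, g₂, t₁, t₂, b₁, b₂, ((τ1 : ℤ), w.2), r} : Finset Face).card = 8 := by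
      rw [Finset.card_insert_of_notMem (by simp only [Finset.mem_insert, Finset.mem_singleton, not_or]; exact ⟨hg12, n1, n2, n3, n4, n5, a4⟩),
        Finset.card_insert_of_notMem (by simp only [Finset.mem_insert, Finset.mem_singleton, not_or]; exact ⟨m1, m2, m3, m4, m5, c4⟩),
        Finset.card_insert_of_notMem (by simp only [Finset.mem_insert, Finset.mem_singleton, not_or]; exact ⟨h01, h02, h03, h04, h05⟩),
        Finset.card_insert_of_notMem (by simp only [Finset.mem_insert, Finset.mem_singleton, not_or]; exact ⟨h12, h13, h14, h15⟩),
        Finset.card_insert_of_notMem (by simp only [Finset.mem_insert, Finset.mem_singleton, not_or]; exact ⟨h23, h24, h25⟩),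
        Finset.card_insert_of_notMem (by simp only [Finset.mem_insert, Finset.mem_singleton, not_or]; exact ⟨h34, h35⟩),
        Finset.card_insert_of_notMem (by simp only [Finset.mem_singleton]; exact h45), Finset.card_singleton]
    have := hle7 _ hT
    omega
  ---------------------------------------------------------------- the horizontal chain of `r` ends at a seventh isolated turn `e₁` on the row of `r`
  have hr₂ : Y' < r.2 := by omega
  have hr₃ : r.2 < Y := lt_of_le_of_ne hrY hrtop
  obtain ⟨e₁, hPe₁, he₁row, he₁ne⟩ : ∃ e₁ : Face, P e₁ ∧ e₁.2 = r.2 ∧ e₁ ≠ r := by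
    -- the arc of `r` turns: it uses `W` or `E`
    have hne := ω.2.sIn_ne_sOut hF
    have key : (ω.2.sIn ω.2.firstHitG = .E ∨ ω.2.sOut ω.2.firstHitG = .E) ∨ (ω.2.sIn ω.2.firstHitG = .W ∨ ω.2.sOut ω.2.firstHitG = .W) := by
      revert hne hNS; cases ω.2.sIn ω.2.firstHitG <;> cases ω.2.sOut ω.2.firstHitG <;> decide
    rcases key with hE | hW
    · obtain ⟨M, hWall, -, hend⟩ := ω.2.chain_E hX' ⟨_, hF, hfcF, hE⟩
      rcases hend with ⟨hM1, hnot⟩ | ⟨-, hs0⟩ | ⟨-, hsZ⟩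
      · obtain ⟨i', hi', hfc', hsv', -, -, -, hk'⟩ := ω.2.isolated_of_usesSide_not_opp (hWall M hM1 le_rfl) hnot
        refine ⟨(r.1 + M, r.2), ?_, rfl, by intro e; have := congrArg Prod.fst e; simp only at this; omega⟩
        have := hPiso i' hi' hsv' hk'; rw [hfc'] at this; exact this
      · exact absurd hs0 h0E
      · exact absurd hsZ hzE
    · obtain ⟨M, hEall, -, hend⟩ := ω.2.chain_W hX ⟨_, hF, hfcF, hW⟩
      rcases hend with ⟨hM1, hnot⟩ | ⟨hA0, -⟩ | ⟨-, hsZ⟩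
      · obtain ⟨i', hi', hfc', hsv', -, -, -, hk'⟩ := ω.2.isolated_of_usesSide_not_opp (hEall M hM1 le_rfl) hnot
        refine ⟨(r.1 - M, r.2), ?_, rfl, by intro e; have := congrArg Prod.fst e; simp only at this; omega⟩
        have := hPiso i' hi' hsv' hk'; rw [hfc'] at this; exact this
      · exfalso; rw [h0w] at hA0; have := congrArg Prod.snd hA0; simp only at this; omega
      · exact absurd hsZ hzW
  -- a vertical chain in the hole column, from a plaquette `c` strictly above the hole downwards, ends at an eighth isolated turn strictly between `c` and the hole
  have hSchain : ∀ c : Face, c.1 = w.1 - 1 → w.2 < c.2 → c.2 ≤ r.2 → ω.2.UsesSide c .S →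
      (c = ω.2.fc (n - 1) → ω.2.sOut (n - 1) ≠ .S) → ∃ e₂ : Face, P e₂ ∧ w.2 < e₂.2 ∧ e₂.2 < c.2 := by
    intro c hc1 hc2 hc3 hcS hcL
    obtain ⟨M, hNall, -, hend⟩ := ω.2.chain_S hY' hcS
    rcases hend with ⟨hM1, hnot⟩ | ⟨-, hs0⟩ | ⟨hZ, hsZ⟩
    · obtain ⟨i', hi', hfc', hsv', -, -, -, hk'⟩ := ω.2.isolated_of_usesSide_not_opp (hNall M hM1 le_rfl) hnot
      have hP' : P (c.1, c.2 - M) := by rw [← hfc']; exact hPiso i' hi' hsv' hk'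
      -- the chain does not pass the hole: if `c.2 − M ≤ w.2`, the hole is a chain cell
      have habove' : w.2 < c.2 - M := by
        by_contra hle
        push Not at hle
        obtain ⟨mh, hmh⟩ : ∃ mh : ℕ, (mh : ℤ) = c.2 - w.2 := ⟨(c.2 - w.2).toNat, by omega⟩
        have huse := hNall mh (by omega) (by omega)
        exact hnotD (hmemD huse) (Prod.ext (by simp only [holeFaceW]; omega) (by simp only [holeFaceW]; omega))
      exact ⟨_, hP', habove', by simp only; omega⟩
    · exact absurd hs0 h0S
    · -- the chain ends at the last plaquette, left through `S`
      exfalso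
      by_cases hM0 : M = 0
      · subst hM0
        have e : c = ω.2.fc (n - 1) := by rw [← hZ]; simp
        exact hcL e hsZ
      · -- then the last plaquette lies below `c` in the hole column and above the hole, and is left through `S` into … `r`? No: `r` lies above it.
        rcases hLcases with ⟨-, hsS, hL⟩ | ⟨-, hsN, -⟩
        · rw [hL] at hZ; have := congrArg Prod.snd hZ; simp only at this; omega
        · rw [hsN] at hsZ; exact absurd hsZ (by decide)
  ---------------------------------------------------------------- the two ends
  rcases hLcases with ⟨hωN, hsS, hL⟩ | ⟨hωS, hsN, hL⟩
  · -- `ω.1 = N`: the arc of `r` does not use `N`, so (turning) it uses `S`; its chain towards the hole gives the eighth turn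
    have hrS : ω.2.UsesSide r .S := by
      have hne := ω.2.sIn_ne_sOut hF
      have hnoN : ¬(ω.2.sIn ω.2.firstHitG = .N ∨ ω.2.sOut ω.2.firstHitG = .N) := fun hs => hrside .N ⟨_, hF, hfcF, hs⟩ (by rw [hωN])
      have key : ω.2.sIn ω.2.firstHitG = .S ∨ ω.2.sOut ω.2.firstHitG = .S := by
        revert hne hnoN hNS; cases ω.2.sIn ω.2.firstHitG <;> cases ω.2.sOut ω.2.firstHitG <;> decide
      exact ⟨_, hF, hfcF, key⟩
    obtain ⟨e₂, hPe₂, he₂lo, he₂hi⟩ := hSchain r hcol habove le_rfl hrS (fun e => absurd e.symm hlastr)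
    exact houts2 e₁ e₂ hPe₁ hPe₂ (hne_of_row _ _ (by omega)) (by omega) (by omega) (by omega) he₁ne (by omega) (by omega) (by omega)
      (hne_of_row _ _ (by omega))
  · -- `ω.1 = S`: the last plaquette `L = (r.1, r.2 − 1)` lies in the hole column strictly above the hole
    have hL2 : w.2 < r.2 - 1 := by
      by_contra hle
      exact hnotD hLD (by rw [hL]; exact Prod.ext (by simp only [holeFaceW]; omega) (by simp only [holeFaceW]; omega))
    -- `L` is an isolated turn (eighth) or uses `S` (then its chain gives the eighth)
    by_cases hLS : ω.2.UsesSide (ω.2.fc (n - 1)) .S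
    · obtain ⟨e₂, hPe₂, he₂lo, he₂hi⟩ := hSchain (ω.2.fc (n - 1)) (by rw [hL]; exact hcol) (by rw [hL]; exact hL2) (by rw [hL]; simp only; omega)
        hLS (fun _ => by rw [hsN]; decide)
      rw [hL] at he₂hi
      exact houts2 e₁ e₂ hPe₁ hPe₂ (hne_of_row _ _ (by simp only at he₂hi; omega)) (by omega) (by omega) (by omega) he₁ne (by omega)
        (by simp only at he₂hi; omega) (by omega) (hne_of_row _ _ (by simp only at he₂hi; omega))
    · -- `L` does not use `S`: it is singly visited (a double visit uses every side) and its arc turns (`W/E → N`)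
      have hsvL : ∀ j < n, ω.2.fc j = ω.2.fc (n - 1) → j = n - 1 := by
        intro j hj e
        by_contra hne
        exact hLS (by have := ω.2.usesSide_of_fc_eq hj hn1 hne e .S; rwa [e] at this)
      have hkL : arcKind (ω.2.sIn (n - 1)) (ω.2.sOut (n - 1)) ≠ .straight := by
        have hne := ω.2.sIn_ne_sOut hn1
        have hnS : ω.2.sIn (n - 1) ≠ .S := fun e => hLS ⟨_, hn1, rfl, Or.inl e⟩
        revert hne hnS; rw [hsN]; cases ω.2.sIn (n - 1) <;> decide
      have hPL : P (ω.2.fc (n - 1)) := hPiso _ hn1 hsvL hkL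
      rw [hL] at hPL
      exact houts2 e₁ (r.1, r.2 - 1) hPe₁ hPL (hne_of_row _ _ (by simp only; omega)) (by omega) (by omega) (by omega) he₁ne
        (by simp only; omega) (by simp only; omega) (by simp only; omega) (by intro e; have := congrArg Prod.snd e; simp only at this; omega)

/-- ★★★ **HOLE COLUMN: A SLANTED LEVEL-`7` CLASS-`B2a` MEMBER HAS A STRAIGHT FIRST ARC.** No wound class-`B2a` walk of limit cost `7` from the hole root `w.side W` (hole
absent) ending on a slanted side of a rhombus `r` of the hole column (`r.1 = w.1 − 1`) has a turning first arc in `r` — above the hole by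
`not_cost_seven_slanted_turn_holeColumn_above`, below by its row reflection. [cite: GlazmanManolescu2019, §1, Fig. 1 and eq. (1); Lemma 2.1; Remark 2.2; §4.2 (lattice symmetries)]
[cite: Glazman2015WeightedSAW, Lemma 3.1 (proof, pp. 6–7)] [cite: CourantRobbins1958, Ch. V Appendix §2 (the even–odd rule)] -/
theorem not_cost_seven_slanted_turn_holeColumn (hh : holeFaceW w ∉ D) (hr : RootedFace D (w.side .W) r) (h : ω.IsB2a)
    (hA : ω.AJ hr h (toC (midPt (w.side .W))) ≠ 0) (hc : cost (slotOfSide ω.1) ω.2.mids = 7) (hz : ω.1 = .N ∨ ω.1 = .S)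
    (hNS : arcKind (ω.2.sIn ω.2.firstHitG) (ω.2.sOut ω.2.firstHitG) ≠ .straight) (hcol : r.1 = w.1 - 1) : False := by
  have hF := ω.fh_lt h
  have hfcF := (fc_fh ω hr h).1
  have hrD : r ∈ D := by rw [← hfcF]; exact (YBWalk.arcFace_arcAt hF).2
  have hrow : r.2 ≠ w.2 := by
    intro e
    exact hh ((show r = holeFaceW w from Prod.ext (by simp only [holeFaceW]; omega) (by simp only [holeFaceW]; exact e)) ▸ hrD)
  rcases lt_or_gt_of_ne hrow with hbelow | habove
  · -- reflect in the root row
    have hh' : holeFaceW w ∉ rowMirrorDom w D := by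
      rw [mem_rowMirrorDom]
      have e : mirrorRowFace w.2 (holeFaceW w) = holeFaceW w := by
        simp only [mirrorRowFace, holeFaceW]; exact Prod.ext rfl (by simp only; ring)
      rw [e]; exact hh
    have hr' := rootedFace_rowMirrorDom_mirrorRowFace (w := w) hr
    have h' := isB2a_mirrorAt hr h
    have hA' := AJ_mirrorAt_ne_zero hr h hA
    have hc' : cost (slotOfSide ω.mirrorAt.1) ω.mirrorAt.2.mids = 7 := by
      show cost (slotOfSide (mirrorSide ω.1)) (ω.2.mids.map (mirrorRow w.2)) = 7
      rw [cost_map_mirrorRow]; exact hc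
    have hz' : ω.mirrorAt.1 = .N ∨ ω.mirrorAt.1 = .S := by
      show mirrorSide ω.1 = .N ∨ mirrorSide ω.1 = .S
      rcases hz with e | e <;> rw [e]
      · exact Or.inr rfl
      · exact Or.inl rfl
    have hFm : ω.mirrorAt.2.firstHitG = ω.2.firstHitG := YBWalk.firstHitG_eq_of_mids_mirror ω.mirrorAt_mids
    have hNS' : arcKind (ω.mirrorAt.2.sIn ω.mirrorAt.2.firstHitG) (ω.mirrorAt.2.sOut ω.mirrorAt.2.firstHitG) ≠ .straight := by
      obtain ⟨e1, e2⟩ := YBWalk.sIn_sOut_eq_of_mids_mirror ω.mirrorAt_mids (i := ω.2.firstHitG) hF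
      rw [hFm, e1, e2, arcKind_mirrorSide]
      have hmk : ∀ k : ArcKind, mirrorKind k = .straight → k = .straight := by intro k; cases k <;> decide
      exact fun hk => hNS (hmk _ hk)
    have habove' : w.2 < (mirrorRowFace w.2 r).2 := by simp only [mirrorRowFace]; omega
    have key := not_cost_seven_slanted_turn_holeColumn_above (ω := ω.mirrorAt) hh' hr' h' hA' hc' hz' hNS' hcol habove'
    exact key
  · exact not_cost_seven_slanted_turn_holeColumn_above hh hr h hA hc hz hNS hcol habove

end ΩG

end Literature.Probability.RandomPlanarGeometry.SAW.YangBaxter
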